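import Summits.HubbardSuperconductivity.HubbardSuperconductivity.Theorems.JosephsonMirrorMirrorSymmetry

/-!
# Route `JosephsonMirror` — reflection positivity of the window double (abstract core)

Helper file for support item stmt-HubbardSuperconductivity-2230 (`JmPositiveMinimiser`) of route
`JosephsonMirror` (sub-problem `HubbardSuperconductivity`): Lieb's `|W|` argument for the window
double `H(J) = A ⊗ 1 + 1 ⊗ Aᵀ - J (D ⊗ D̄ + Dᴴ ⊗ D̄ᴴ)`, `J ≥ 0`, on a coordinate window `S` made of
two disjoint diagonal blocks.

* `re_trace_unitConj_mul_conjTranspose_le`: Lieb's trace inequality in sesquilinear form,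
  `Re tr (W X W Xᴴ) ≤ Re tr (|W| X |W| Xᴴ)` for Hermitian `W` and ANY `X` (no Hermitian
  quadratures needed: in the eigenbasis of `W` both sides are `Σ w_a w_b |N_{ab}|²`).
* `re_hsInner_windowOp_abs_le`: hence `⟨|W|, 𝓛 |W|⟩ ≤ ⟨W, 𝓛 W⟩` for the matrix map
  `𝓛 W = A W + W A - J (D W Dᴴ + Dᴴ W D)` (`|W|² = W²` takes care of the `A`-terms).
* `unitConj_abs_apply_eq_zero`: `|W|` keeps the block support of `W` (`|W| = cfc |·| W` commutes
  with the block projections, and `|W|² = W²` kills the off-window corner).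
* **`exists_posSemidef_window_minimiser`**: the window problem has a minimiser `ψ_W` with
  `W = Vᴴ V` positive semidefinite, supported in the window, `‖ψ_W‖ = 1`, energy `E(J)`.

Sources: E. H. Lieb, Phys. Rev. Lett. 62 (1989) 1201, proof of Theorem 1; F. J. Dyson, E. H. Lieb,
B. Simon, J. Stat. Phys. 18 (1978) 335, §2 (reflection positivity). No new definitions.
-/

-- the mandated namespace `Summit.<Summit>.<Problem>.Theorems` repeats `HubbardSuperconductivity`
-- (single-problem summit, D-0017), which the `dupNamespace` linter flags on every declaration
set_option linter.dupNamespace false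

namespace Summit.HubbardSuperconductivity.HubbardSuperconductivity.Theorems.JosephsonMirror

open Matrix Literature.MathematicalPhysics.QuantumLattice
open scoped Kronecker ComplexOrder

variable {ι : Type*} [Fintype ι] [DecidableEq ι]

/-- **Lieb's trace inequality**, sesquilinear form: for `W = V D_w Vᴴ` and any `X`,
`Re tr (W X W Xᴴ) = Σ_{a,b} w_a w_b |N_{ab}|² ≤ Σ_{a,b} |w_a| |w_b| |N_{ab}|² = Re tr (|W| X |W| Xᴴ)`
(`N = Vᴴ X V`). Lieb, PRL 62 (1989) 1201, proof of Theorem 1 (displayed inequality after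
eq. (4)). [folklore] -/
theorem re_trace_unitConj_mul_conjTranspose_le (V : Matrix ι ι ℂ) (f : ι → ℝ) (X : Matrix ι ι ℂ) :
    ((unitConj V f * X * unitConj V f * Xᴴ).trace).re ≤
      ((unitConj V |f| * X * unitConj V |f| * Xᴴ).trace).re := by
  set N := Vᴴ * X * V with hN
  have hN' : Vᴴ * Xᴴ * V = Nᴴ := by
    rw [hN, conjTranspose_mul, conjTranspose_mul, conjTranspose_conjTranspose, Matrix.mul_assoc]
  have key : ∀ g : ι → ℝ, ((unitConj V g * X * unitConj V g * Xᴴ).trace).re =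
      ∑ a, ∑ b, g a * g b * ‖N a b‖ ^ 2 := by
    intro g
    rw [trace_unitConj_mul_mul, ← hN, hN', trace_diagonal_mul_mul_diagonal_mul, Complex.re_sum]
    refine Finset.sum_congr rfl fun a _ => ?_
    rw [Complex.re_sum]
    refine Finset.sum_congr rfl fun b _ => ?_
    rw [conjTranspose_apply, Complex.star_def,
      show (g a : ℂ) * N a b * (g b : ℂ) * (starRingEnd ℂ) (N a b) =
        (g a : ℂ) * (g b : ℂ) * (N a b * (starRingEnd ℂ) (N a b)) by ring, Complex.mul_conj']
    norm_cast
  rw [key, key]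
  refine Finset.sum_le_sum fun a _ => Finset.sum_le_sum fun b _ => ?_
  refine mul_le_mul_of_nonneg_right ?_ (sq_nonneg _)
  rw [Pi.abs_apply, Pi.abs_apply, ← abs_mul]
  exact le_abs_self _

omit [DecidableEq ι] in
/-- Lieb's energy functional of the window double on a Hermitian matrix:
`⟨W, 𝓛 W⟩ = tr (A W²) + tr (W² A) - J (tr (W D W Dᴴ) + tr (W Dᴴ W D))`. Lieb, PRL 62 (1989)
1201, eq. (3). [folklore] -/
theorem hsInner_windowOp_of_conjTranspose_eq (A D : Matrix ι ι ℂ) (J : ℝ) {W : Matrix ι ι ℂ}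
    (hW : Wᴴ = W) :
    hsInner W (A * W + W * A - (J : ℂ) • (D * W * Dᴴ + Dᴴ * W * D)) =
      (A * (W * W)).trace + (W * W * A).trace -
        (J : ℂ) * ((W * D * W * Dᴴ).trace + (W * Dᴴ * W * D).trace) := by
  rw [hsInner, hW]
  simp only [Matrix.mul_sub, Matrix.mul_add, Matrix.mul_smul, trace_sub, trace_add, trace_smul,
    smul_eq_mul]
  have e1 : (W * (A * W)).trace = (A * (W * W)).trace := by rw [trace_mul_comm, Matrix.mul_assoc]
  have e2 : (W * (W * A)).trace = (W * W * A).trace := by rw [Matrix.mul_assoc]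
  have e3 : (W * (D * W * Dᴴ)).trace = (W * D * W * Dᴴ).trace := by simp only [Matrix.mul_assoc]
  have e4 : (W * (Dᴴ * W * D)).trace = (W * Dᴴ * W * D).trace := by simp only [Matrix.mul_assoc]
  rw [e1, e2, e3, e4]

/-- **`E(|W|) ≤ E(W)`** for the window double with `J ≥ 0`: `|W|² = W²` leaves the `A`-terms
unchanged and Lieb's trace inequality lowers the two coupling traces. Lieb, PRL 62 (1989) 1201,
proof of Theorem 1 ("Since `U_x ≤ 0`, I conclude that `E(W) ≥ E(|W|)`"). [folklore] -/
theorem re_hsInner_windowOp_abs_le (A D : Matrix ι ι ℂ) {J : ℝ} (hJ : 0 ≤ J) {V : Matrix ι ι ℂ}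
    (hV : Vᴴ * V = 1) (f : ι → ℝ) :
    (hsInner (unitConj V |f|) (A * unitConj V |f| + unitConj V |f| * A -
        (J : ℂ) • (D * unitConj V |f| * Dᴴ + Dᴴ * unitConj V |f| * D))).re ≤
      (hsInner (unitConj V f) (A * unitConj V f + unitConj V f * A -
        (J : ℂ) • (D * unitConj V f * Dᴴ + Dᴴ * unitConj V f * D))).re := by
  rw [hsInner_windowOp_of_conjTranspose_eq A D J (unitConj_conjTranspose V |f|),
    hsInner_windowOp_of_conjTranspose_eq A D J (unitConj_conjTranspose V f),
    unitConj_abs_mul_self V (hV := hV) f]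
  simp only [Complex.sub_re, Complex.add_re, Complex.re_ofReal_mul]
  have h1 := re_trace_unitConj_mul_conjTranspose_le V f D
  have h2 := re_trace_unitConj_mul_conjTranspose_le V f Dᴴ
  rw [conjTranspose_conjTranspose] at h2
  nlinarith

/-- A block-diagonal Hermitian `W` has block-diagonal `|W|`: if `W = V D_w Vᴴ` is supported on the
pairs lying in a common block (`P₁` or `P₂`, disjoint), so is `|W| = V D_{|w|} Vᴴ`. (`|W|` is the
continuous functional calculus `cfc |·| W`, which commutes with the block projections because `W`
does; and `|W|² = W²` vanishes on the off-block corner, so `|W|` does.) Lieb, PRL 62 (1989) 1201,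
proof of Theorem 1 (working in one `S^z` sector). [folklore] -/
theorem unitConj_abs_apply_eq_zero {W : Matrix ι ι ℂ} (hW : W.IsHermitian)
    (P₁ P₂ : ι → Prop) (h12 : ∀ s, P₁ s → ¬ P₂ s) (good : ι × ι → Prop)
    (hgood : ∀ s t, good (s, t) → (P₁ s ∧ P₁ t) ∨ (P₂ s ∧ P₂ t))
    (hgood₁ : ∀ s t, P₁ s → P₁ t → good (s, t)) (hgood₂ : ∀ s t, P₂ s → P₂ t → good (s, t))
    (hsupp : ∀ s t, ¬ good (s, t) → W s t = 0) :
    ∀ s t, ¬ good (s, t) →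
      unitConj (hW.eigenvectorUnitary : Matrix ι ι ℂ) |hW.eigenvalues| s t = 0 := by
  classical
  set V : Matrix ι ι ℂ := (hW.eigenvectorUnitary : Matrix ι ι ℂ) with hVdef
  set f : ι → ℝ := hW.eigenvalues with hf
  have hV : Vᴴ * V = 1 := by
    rw [← star_eq_conjTranspose]
    exact Unitary.coe_star_mul_self hW.eigenvectorUnitary
  have hWeq : W = unitConj V f := by
    conv_lhs => rw [hW.spectral_theorem]
    rw [Unitary.conjStarAlgAut_apply, star_eq_conjTranspose]
    rfl
  set R : Matrix ι ι ℂ := unitConj V |f| with hR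
  have hRcfc : cfc (fun x : ℝ => |x|) W = R := by
    rw [hW.cfc_eq, Matrix.IsHermitian.cfc, Unitary.conjStarAlgAut_apply, star_eq_conjTranspose]
    rfl
  -- block projections
  set Q₁ : Matrix ι ι ℂ := diagonal fun s => if P₁ s then 1 else 0 with hQ₁
  set Q₂ : Matrix ι ι ℂ := diagonal fun s => if P₂ s then 1 else 0 with hQ₂
  have hcomm : ∀ (P : ι → Prop) (hP : ∀ s t, good (s, t) → (P s ↔ P t)),
      Commute W (diagonal fun s => if P s then (1 : ℂ) else 0) := by
    intro P hP
    ext s t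
    rw [mul_diagonal, diagonal_mul]
    by_cases hst : good (s, t)
    · have := hP s t hst
      by_cases hs : P s
      · rw [if_pos hs, if_pos (this.1 hs), mul_one, one_mul]
      · rw [if_neg hs, if_neg (fun h => hs (this.2 h)), mul_zero, zero_mul]
    · rw [hsupp s t hst, mul_zero, zero_mul]
  have hP₁ : ∀ s t, good (s, t) → (P₁ s ↔ P₁ t) := by
    intro s t hst
    rcases hgood s t hst with ⟨hs, ht⟩ | ⟨hs, ht⟩
    · exact ⟨fun _ => ht, fun _ => hs⟩
    · exact ⟨fun h => absurd hs (h12 s h), fun h => absurd ht (h12 t h)⟩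
  have hP₂ : ∀ s t, good (s, t) → (P₂ s ↔ P₂ t) := by
    intro s t hst
    rcases hgood s t hst with ⟨hs, ht⟩ | ⟨hs, ht⟩
    · exact ⟨fun h => absurd h (h12 s hs), fun h => absurd h (h12 t ht)⟩
    · exact ⟨fun _ => ht, fun _ => hs⟩
  have hRQ₁ : Commute R Q₁ := by
    rw [← hRcfc, hQ₁]
    exact (hcomm P₁ hP₁).cfc_real _
  have hRQ₂ : Commute R Q₂ := by
    rw [← hRcfc, hQ₂]
    exact (hcomm P₂ hP₂).cfc_real _
  -- `W (Q₁ + Q₂) = W`, hence `R (Q₁ + Q₂) = R`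
  have hWQ : W * (Q₁ + Q₂) = W := by
    ext s t
    rw [Matrix.mul_add, Matrix.add_apply, hQ₁, hQ₂, mul_diagonal, mul_diagonal]
    by_cases hst : good (s, t)
    · rcases hgood s t hst with ⟨-, ht⟩ | ⟨-, ht⟩
      · rw [if_pos ht, if_neg (h12 t ht), mul_one, mul_zero, add_zero]
      · rw [if_pos ht, if_neg (fun h => h12 t h ht), mul_one, mul_zero, zero_add]
    · rw [hsupp s t hst, zero_mul, zero_mul, add_zero]
  have hRR : R * R = W * W := by
    rw [hR, hWeq]
    exact unitConj_abs_mul_self V (hV := hV) f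
  have hRh : Rᴴ = R := unitConj_conjTranspose V |f|
  have hRQ : R * (Q₁ + Q₂) = R := by
    have hT : (R * (1 - (Q₁ + Q₂)))ᴴ * (R * (1 - (Q₁ + Q₂))) = 0 := by
      rw [conjTranspose_mul, Matrix.mul_assoc, ← Matrix.mul_assoc Rᴴ, hRh, hRR, Matrix.mul_sub,
        Matrix.mul_one, Matrix.mul_assoc W W, hWQ, sub_self, Matrix.mul_zero]
    have h0 := Matrix.conjTranspose_mul_self_eq_zero.1 hT
    rw [Matrix.mul_sub, Matrix.mul_one, sub_eq_zero] at h0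
    exact h0.symm
  -- read off the support
  intro s t hst
  by_contra hne
  have e₁ := congrFun (congrFun hRQ₁.eq s) t
  have e₂ := congrFun (congrFun hRQ₂.eq s) t
  have e₀ := congrFun (congrFun hRQ s) t
  rw [hQ₁, mul_diagonal, diagonal_mul] at e₁
  rw [hQ₂, mul_diagonal, diagonal_mul] at e₂
  rw [Matrix.mul_add, Matrix.add_apply, hQ₁, hQ₂, mul_diagonal, mul_diagonal] at e₀
  apply hst
  by_cases h1t : P₁ t
  · have h1s : P₁ s := by
      by_contra h1s
      rw [if_pos h1t, if_neg h1s, mul_one, zero_mul] at e₁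
      exact hne e₁
    exact hgood₁ s t h1s h1t
  · by_cases h2t : P₂ t
    · have h2s : P₂ s := by
        by_contra h2s
        rw [if_pos h2t, if_neg h2s, mul_one, zero_mul] at e₂
        exact hne e₂
      exact hgood₂ s t h2s h2t
    · rw [if_neg h1t, if_neg h2t, mul_zero, add_zero] at e₀
      exact absurd e₀.symm hne

/-- **Reflection positivity of the window double** (abstract form of `JmPositiveMinimiser`): for
Hermitian `A`, any `D`, `J ≥ 0`, and the coordinate window `S` of two-layer vectors supported on
the pairs lying in a common block (`P₁` or `P₂`, disjoint, `P₁` nonempty), the window problem for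
`H(J) = A ⊗ 1 + 1 ⊗ Aᵀ - J (D ⊗ D̄ + Dᴴ ⊗ D̄ᴴ)` has a minimiser `ψ_W`, `W = Vᴴ V` positive
semidefinite and supported in the window, `‖ψ_W‖ = 1`, of energy `E(J) = minEnergyOn (H(J)) S`.
Proof: a Hermitian ground matrix `W` exists (`exists_hermitian_window_groundMatrix`); `|W|` has
the same norm, stays in the window and does not raise the energy, so it is a minimiser; normalise.
Lieb, PRL 62 (1989) 1201, proof of Theorem 1; Dyson–Lieb–Simon, J. Stat. Phys. 18 (1978) 335.
[folklore] -/
theorem exists_posSemidef_window_minimiser (A D : Matrix ι ι ℂ) (hA : A.IsHermitian)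
    (P₁ P₂ : ι → Prop) (h12 : ∀ s, P₁ s → ¬ P₂ s) (good : ι × ι → Prop)
    (hgood : ∀ s t, good (s, t) → (P₁ s ∧ P₁ t) ∨ (P₂ s ∧ P₂ t))
    (hgood₁ : ∀ s t, P₁ s → P₁ t → good (s, t)) (hgood₂ : ∀ s t, P₂ s → P₂ t → good (s, t))
    (hne : ∃ s, P₁ s) (S : Submodule ℂ (ι × ι → ℂ)) (hS : ∀ ψ, ψ ∈ S ↔ ∀ p, ¬ good p → ψ p = 0)
    {J : ℝ} (hJ : 0 ≤ J) :
    ∃ W V : Matrix ι ι ℂ, W = Vᴴ * V ∧ (∀ s t, ¬ good (s, t) → W s t = 0) ∧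
      star (fun p : ι × ι => W p.1 p.2) ⬝ᵥ (fun p : ι × ι => W p.1 p.2) = 1 ∧
      (star (fun p : ι × ι => W p.1 p.2) ⬝ᵥ
          (A ⊗ₖ (1 : Matrix ι ι ℂ) + (1 : Matrix ι ι ℂ) ⊗ₖ Aᵀ -
            (J : ℂ) • (D ⊗ₖ Dᴴᵀ + Dᴴ ⊗ₖ Dᵀ)) *ᵥ (fun p : ι × ι => W p.1 p.2)).re =
        (A ⊗ₖ (1 : Matrix ι ι ℂ) + (1 : Matrix ι ι ℂ) ⊗ₖ Aᵀ -
            (J : ℂ) • (D ⊗ₖ Dᴴᵀ + Dᴴ ⊗ₖ Dᵀ)).minEnergyOn S := by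
  classical
  set M : Matrix (ι × ι) (ι × ι) ℂ := A ⊗ₖ (1 : Matrix ι ι ℂ) + (1 : Matrix ι ι ℂ) ⊗ₖ Aᵀ -
    (J : ℂ) • (D ⊗ₖ Dᴴᵀ + Dᴴ ⊗ₖ Dᵀ) with hM
  have hMh : M.IsHermitian := isHermitian_windowDouble hA D J
  have hsymm : ∀ s t, good (s, t) → good (t, s) := by
    intro s t hst
    rcases hgood s t hst with ⟨hs, ht⟩ | ⟨hs, ht⟩
    · exact hgood₁ t s ht hs
    · exact hgood₂ t s ht hs
  obtain ⟨s₀, hs₀⟩ := hne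
  obtain ⟨W, hWh', hW0, hWsupp, hWE⟩ := exists_hermitian_window_groundMatrix A D hA J good hsymm
    ⟨(s₀, s₀), hgood₁ _ _ hs₀ hs₀⟩ S hS
  rw [← hM] at hWE
  have hWh : W.IsHermitian := hWh'
  set E : ℝ := M.minEnergyOn S with hE
  -- spectral decomposition and `|W|`
  set V : Matrix ι ι ℂ := (hWh.eigenvectorUnitary : Matrix ι ι ℂ) with hVdef
  set f : ι → ℝ := hWh.eigenvalues with hf
  have hV : Vᴴ * V = 1 := by
    rw [← star_eq_conjTranspose]
    exact Unitary.coe_star_mul_self hWh.eigenvectorUnitary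
  have hWeq : W = unitConj V f := by
    conv_lhs => rw [hWh.spectral_theorem]
    rw [Unitary.conjStarAlgAut_apply, star_eq_conjTranspose]
    rfl
  set R : Matrix ι ι ℂ := unitConj V |f| with hR
  have hRsupp : ∀ s t, ¬ good (s, t) → R s t = 0 :=
    unitConj_abs_apply_eq_zero hWh P₁ P₂ h12 good hgood hgood₁ hgood₂ hWsupp
  have hRR' : hsInner R R = hsInner W W := by
    rw [hR, hWeq]
    exact hsInner_unitConj_abs_self hV f
  -- energies
  have hRE : (hsInner R (A * R + R * A - (J : ℂ) • (D * R * Dᴴ + Dᴴ * R * D))).re ≤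
      E * (hsInner R R).re := by
    rw [hRR', ← hWE, hR, hWeq]
    exact re_hsInner_windowOp_abs_le A D hJ hV f
  -- the packaged vector of `R`
  set r : ι × ι → ℂ := fun p => R p.1 p.2 with hr
  have hrS : r ∈ S := (hS r).2 fun p hp => hRsupp p.1 p.2 hp
  have hrr : star r ⬝ᵥ r = hsInner R R := star_vec_dotProduct_vec R R
  have hrM : star r ⬝ᵥ M *ᵥ r = hsInner R (A * R + R * A - (J : ℂ) • (D * R * Dᴴ + Dᴴ * R * D)) := by
    rw [hr, hM]
    exact star_vec_dotProduct_windowDouble_mulVec_vec A D R J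
  set q : ℝ := (hsInner R R).re with hq
  have hq0 : 0 < q := by
    rcases (hsInner_self_re_nonneg R).lt_or_eq with h | h
    · exact h
    · exfalso
      have : (hsInner W W).re = 0 := by rw [← hRR', ← h]
      exact hW0 ((hsInner_self_re_eq_zero_iff W).1 this)
  have hqc : hsInner R R = (q : ℂ) := by
    rw [hq, hsInner_self_eq, Complex.ofReal_re]
  -- normalisation
  set c : ℝ := (Real.sqrt q)⁻¹ with hc
  have hc0 : 0 < c := inv_pos.2 (Real.sqrt_pos.2 hq0)
  have hcq : c * c * q = 1 := by
    rw [hc, ← mul_inv, Real.mul_self_sqrt hq0.le, inv_mul_cancel₀ hq0.ne']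
  refine ⟨(c : ℂ) • R, diagonal (fun a => ((Real.sqrt (c * |f a|) : ℝ) : ℂ)) * Vᴴ, ?_, ?_, ?_, ?_⟩
  · -- `c |W| = (D_{√(c|w|)} Vᴴ)ᴴ (D_{√(c|w|)} Vᴴ)`
    have hd : (diagonal fun a => ((Real.sqrt (c * |f a|) : ℝ) : ℂ))ᴴ =
        diagonal fun a => ((Real.sqrt (c * |f a|) : ℝ) : ℂ) := by
      rw [diagonal_conjTranspose]
      congr 1
      funext a
      simp
    have hg : ∀ a, ((Real.sqrt (c * |f a|) : ℝ) : ℂ) * ((Real.sqrt (c * |f a|) : ℝ) : ℂ) =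
        (((c • |f|) a : ℝ) : ℂ) := by
      intro a
      rw [← Complex.ofReal_mul, Real.mul_self_sqrt (mul_nonneg hc0.le (abs_nonneg _)),
        Pi.smul_apply, Pi.abs_apply, smul_eq_mul]
    rw [conjTranspose_mul, conjTranspose_conjTranspose, hd, Matrix.mul_assoc,
      ← Matrix.mul_assoc (diagonal _), diagonal_mul_diagonal, hR, ← unitConj_smul, unitConj,
      ← Matrix.mul_assoc]
    simp only [hg]
  · intro s t hst
    rw [Matrix.smul_apply, hRsupp s t hst, smul_zero]
  · show star ((c : ℂ) • r) ⬝ᵥ ((c : ℂ) • r) = 1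
    rw [star_smul, smul_dotProduct, dotProduct_smul, smul_smul, hrr, hqc, Complex.star_def,
      Complex.conj_ofReal, smul_eq_mul]
    exact_mod_cast hcq
  · show (star ((c : ℂ) • r) ⬝ᵥ M *ᵥ ((c : ℂ) • r)).re = E
    have hψS : (c : ℂ) • r ∈ S := S.smul_mem _ hrS
    have hψ1 : star ((c : ℂ) • r) ⬝ᵥ ((c : ℂ) • r) = 1 := by
      rw [star_smul, smul_dotProduct, dotProduct_smul, smul_smul, hrr, hqc, Complex.star_def,
        Complex.conj_ofReal, smul_eq_mul]
      exact_mod_cast hcq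
    have hlow := minEnergyOn_le_rayleigh_of_mem hMh S hψS hψ1
    have hval : (star ((c : ℂ) • r) ⬝ᵥ M *ᵥ ((c : ℂ) • r)).re = c * c * (star r ⬝ᵥ M *ᵥ r).re := by
      rw [mulVec_smul, star_smul, smul_dotProduct, dotProduct_smul, smul_smul, Complex.star_def,
        Complex.conj_ofReal, smul_eq_mul, ← Complex.ofReal_mul, Complex.re_ofReal_mul]
    rw [hval] at hlow ⊢
    rw [hrM] at hlow ⊢
    have hcc : 0 ≤ c * c := mul_self_nonneg c
    have h1 : c * c * (hsInner R (A * R + R * A - (J : ℂ) • (D * R * Dᴴ + Dᴴ * R * D))).re ≤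
        E := by
      calc c * c * (hsInner R (A * R + R * A - (J : ℂ) • (D * R * Dᴴ + Dᴴ * R * D))).re
          ≤ c * c * (E * (hsInner R R).re) := mul_le_mul_of_nonneg_left hRE hcc
        _ = E := by rw [← hq, ← mul_assoc, mul_comm (c * c) E, mul_assoc, hcq, mul_one]
    exact le_antisymm h1 hlow

end Summit.HubbardSuperconductivity.HubbardSuperconductivity.Theorems.JosephsonMirror
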